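import Literature.NumberTheory.Sieve.NumberFieldLargeSieveCharacters
import Literature.NumberTheory.Sieve.NumberFieldVaughanIdentity
import HarnessLib

/-!
# Reduction of character sums to primitive characters (the conductor argument)

Topic `Literature/NumberTheory/Sieve`, sub-namespace `PrimRed`. In the Bombieri–Vinogradov
theorem the mean value over all nontrivial characters `χ mod 𝔮` is reduced to primitive characters:
every `χ mod 𝔮` is induced by a primitive character `χ*` modulo a divisor `𝔣 ∣ 𝔮` (its conductor),
the sums `∑_π w(π) χ(π)` and `∑_π w(π) χ*(π)` differ only by the terms not prime to `𝔮`, and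
`∑_{N𝔮≤Q} φ(𝔮)⁻¹ ∑_{𝔣∣𝔮} G(𝔣) ≤ (∑_{N𝔤≤Q} φ(𝔤)⁻¹) ∑_{N𝔣≤Q} φ(𝔣)⁻¹ G(𝔣)` by `φ(𝔣𝔤) ≥ φ(𝔣)φ(𝔤)`
(Hinz 1988, §2, between (2.3) and (2.4): "`χ mod 𝔮` is induced by a primitive `χ* mod 𝔣`,
`𝔣 ∣ 𝔮` … we arrive at (1.2)"; the classical argument, e.g. Davenport Ch. 28). Everything is
PROVED; only the EXISTENCE of an inducing primitive character is needed (no uniqueness of the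
conductor), which keeps the algebra short:

* `isUnit_mk_iff` — `b` is a unit mod `I` iff `(b) + I = 1`;
* `exists_lift_isUnit` — **units lift**: for `𝔮 ⊆ 𝔣` (`𝔮 ≠ 0`) every unit mod `𝔣` has a
  representative that is a unit mod `𝔮` (CRT with the part of `𝔮` prime to `𝔣`);
* `unitsMap`, `unitsMap_surjective` — `(𝓞/𝔮)ˣ → (𝓞/𝔣)ˣ` is onto;
* `TrivialOn`, `induced`, `unitValue_induced` — a character trivial on `{b ≡ 1 mod 𝔣}` descends to
  `(𝓞/𝔣)ˣ` (`QuotientGroup.lift` through `quotientKerEquivOfSurjective`);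
* `exists_isPrimitiveChar_inducing` — **existence of a primitive inducing character** (a maximal
  `𝔣 ⊇ 𝔮` on whose congruence subgroup `χ` is trivial), nontrivial `χ` giving `𝔣 ≠ 1`;
* `primChars`, `CharIdx` — primitive characters mod `𝔣` as a `Finset`, the index set `{(𝔣, χ)}`;
* `charSum`, `badSum`, `norm_charSum_sub_le` — `|S_𝔮(χ) − S_𝔣(χ*)| ≤ ∑_{α not prime to 𝔮} |w(α)|`;
* `sum_norm_charSum_le` — `∑_{χ≠χ₀ mod 𝔮} |S_𝔮(χ)| ≤ ∑_{𝔣∣𝔮, 𝔣≠1} ∑_{χ* prim mod 𝔣} |S_𝔣(χ*)| + #{χ}·bad`;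
* `idealTotient_mul_ge` — `φ(𝔣𝔤) ≥ φ(𝔣)φ(𝔤)`;
* `sum_inv_totient_sum_divisors_le` — the swap of the sums over `𝔮` and `𝔣 ∣ 𝔮`.

## References

* J. Hinz, *A generalization of Bombieri's prime number theorem to algebraic number fields*,
  Acta Arith. 51 (1988), §2 (reduction to primitive characters, (2.3)–(2.5)). [cite: Hinz1988, §2]
* J. Neukirch, *Algebraic Number Theory*, VII §6 (conductor of a character of `(𝓞/𝔪)ˣ`).
  [cite: NeukirchANT1999, Ch. VII §6]
-/

noncomputable section

open Finset NumberField Ideal UniqueFactorizationMonoid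
  Literature.NumberTheory.Sieve.NumberFieldLS Literature.NumberTheory.Sieve.BoxPrimes
  Literature.NumberTheory.LFunctions.AbelianDensity Literature.NumberTheory.Sieve.MaynardNF
  Literature.NumberTheory.Sieve.NumberFieldVaughan Literature.NumberTheory.NumberFields
open scoped Classical

namespace Literature.NumberTheory.Sieve.PrimRed

variable {K : Type*} [Field K] [NumberField K]

/-! ## Units modulo `𝔮` and modulo a divisor `𝔣 ⊇ 𝔮` -/

section Units

variable {𝔮 𝔣 : Ideal (𝓞 K)}

omit [NumberField K] in
/-- `b` is a unit mod `I` iff `(b) + I = (1)`. [folklore] -/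
theorem isUnit_mk_iff {I : Ideal (𝓞 K)} {b : 𝓞 K} :
    IsUnit (Ideal.Quotient.mk I b) ↔ Ideal.span {b} ⊔ I = ⊤ := by
  refine ⟨fun h => ?_, isUnit_mk_of_sup_eq_top⟩
  obtain ⟨c, hc⟩ := h.exists_right_inv
  obtain ⟨c, rfl⟩ := Ideal.Quotient.mk_surjective c
  rw [← map_mul, ← (Ideal.Quotient.mk I).map_one, Ideal.Quotient.eq] at hc
  rw [eq_top_iff_one]
  have : (1 : 𝓞 K) = b * c - (b * c - 1) := by ring
  rw [this]
  exact Submodule.sub_mem _ (Ideal.mem_sup_left (Ideal.mem_span_singleton'.2 ⟨c, mul_comm c b⟩))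
    (Ideal.mem_sup_right hc)

omit [NumberField K] in
/-- A unit mod `I` lies in no maximal ideal above `I`. [folklore] -/
theorem not_mem_of_isUnit_mk {I 𝔪 : Ideal (𝓞 K)} (h𝔪 : 𝔪.IsMaximal) (hI : I ≤ 𝔪) {b : 𝓞 K}
    (hb : IsUnit (Ideal.Quotient.mk I b)) : b ∉ 𝔪 := by
  intro hbm
  rw [isUnit_mk_iff] at hb
  have : Ideal.span {b} ⊔ I ≤ 𝔪 := sup_le ((Ideal.span_singleton_le_iff_mem _).2 hbm) hI
  rw [hb, top_le_iff] at this
  exact h𝔪.ne_top this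

omit [NumberField K] in
/-- Divisors of nonzero ideals are nonzero. [folklore] -/
theorem ne_bot_of_dvd_ne_bot {𝔞 𝔟 : Ideal (𝓞 K)} (h𝔞 : 𝔞 ≠ ⊥) (h : 𝔟 ∣ 𝔞) : 𝔟 ≠ ⊥ := by
  rintro rfl
  obtain ⟨c, rfl⟩ := h
  exact h𝔞 (by simp)

/-- A maximal ideal containing the nonzero ideal `𝔮` is one of its prime factors. [folklore] -/
theorem mem_factors_of_le {𝔪 : Ideal (𝓞 K)} (h𝔮 : 𝔮 ≠ ⊥) (h𝔪 : 𝔪.IsMaximal) (hle : 𝔮 ≤ 𝔪) :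
    𝔪 ∈ (factors 𝔮).toFinset := by
  have hdvd : 𝔪 ∣ 𝔮 := Ideal.dvd_iff_le.2 hle
  have h𝔪0 : 𝔪 ≠ ⊥ := fun h => h𝔮 (le_bot_iff.1 (h ▸ hle))
  have hirr : Irreducible 𝔪 := (Ideal.prime_of_isPrime h𝔪0 h𝔪.isPrime).irreducible
  obtain ⟨𝔭, h𝔭, hass⟩ := exists_mem_factors_of_dvd h𝔮 hirr hdvd
  rw [Multiset.mem_toFinset, associated_iff_eq.1 hass]
  exact h𝔭

/-- **Units lift along `𝓞/𝔮 → 𝓞/𝔣`** (`𝔮 ≠ 0`; in the application `𝔮 ⊆ 𝔣`): a unit mod `𝔣`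
has a representative which is a unit mod `𝔮`. With `𝔮'` the product of the prime factors of `𝔮` not containing `𝔣`
one has `𝔣 + 𝔮' = 1`, and `y ≡ x (𝔣)`, `y ≡ 1 (𝔮')` works. [folklore] -/
theorem exists_lift_isUnit (h𝔮 : 𝔮 ≠ ⊥) {x : 𝓞 K} (hx : IsUnit (Ideal.Quotient.mk 𝔣 x)) :
    ∃ y : 𝓞 K, y - x ∈ 𝔣 ∧ IsUnit (Ideal.Quotient.mk 𝔮 y) := by
  -- the part of `𝔮` prime to `𝔣`
  set T := (factors 𝔮).toFinset.filter (fun 𝔭 => ¬ 𝔣 ≤ 𝔭) with hT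
  set 𝔮' : Ideal (𝓞 K) := ∏ 𝔭 ∈ T, 𝔭 with h𝔮'
  -- `𝔣 + 𝔮' = 1`
  have hcop : 𝔣 ⊔ 𝔮' = ⊤ := by
    by_contra hne
    obtain ⟨𝔪, h𝔪, hle'⟩ := Ideal.exists_le_maximal _ hne
    have h𝔣𝔪 : 𝔣 ≤ 𝔪 := le_sup_left.trans hle'
    have h𝔮'𝔪 : 𝔮' ≤ 𝔪 := le_sup_right.trans hle'
    rw [h𝔮', h𝔪.isPrime.prod_le] at h𝔮'𝔪
    obtain ⟨𝔭, h𝔭T, h𝔭𝔪⟩ := h𝔮'𝔪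
    rw [hT, Finset.mem_filter] at h𝔭T
    have h𝔭max : 𝔭.IsMaximal := (isMaximal_of_mem_factors (Multiset.mem_toFinset.1 h𝔭T.1)).1
    have : 𝔭 = 𝔪 := h𝔭max.eq_of_le h𝔪.ne_top h𝔭𝔪
    exact h𝔭T.2 (this ▸ h𝔣𝔪)
  obtain ⟨f, hf, g, hg, hfg⟩ := Submodule.mem_sup.1 ((eq_top_iff_one _).1 hcop)
  refine ⟨x * g + f, ?_, ?_⟩
  · have : x * g + f - x = f - x * f := by linear_combination x * hfg
    rw [this]
    exact Submodule.sub_mem _ hf (𝔣.mul_mem_left x hf)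
  · rw [isUnit_mk_iff]
    by_contra hne
    obtain ⟨𝔪, h𝔪, hle'⟩ := Ideal.exists_le_maximal _ hne
    have hy𝔪 : x * g + f ∈ 𝔪 := (Ideal.span_singleton_le_iff_mem _).1 (le_sup_left.trans hle')
    have h𝔮𝔪 : 𝔮 ≤ 𝔪 := le_sup_right.trans hle'
    by_cases h𝔣𝔪 : 𝔣 ≤ 𝔪
    · -- then `x ∈ 𝔪`, contradicting that `x` is a unit mod `𝔣`
      have hx𝔪 : x ∈ 𝔪 := by
        have h1 : x * g + f - x ∈ 𝔪 := by
          have : x * g + f - x = f - x * f := by linear_combination x * hfg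
          rw [this]; exact h𝔣𝔪 (Submodule.sub_mem _ hf (𝔣.mul_mem_left x hf))
        have := Submodule.sub_mem _ hy𝔪 h1
        rwa [sub_sub_cancel] at this
      exact not_mem_of_isUnit_mk h𝔪 h𝔣𝔪 hx hx𝔪
    · -- then `𝔪 ∈ T`, so `g ∈ 𝔮' ⊆ 𝔪` and `1 = (xg + f) - xg + g ∈ 𝔪`
      have h𝔪T : 𝔪 ∈ T := by
        rw [hT, Finset.mem_filter]; exact ⟨mem_factors_of_le h𝔮 h𝔪 h𝔮𝔪, h𝔣𝔪⟩
      have hg𝔪 : g ∈ 𝔪 := by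
        have : 𝔮' ≤ 𝔪 := by
          rw [h𝔮']; exact (Ideal.prod_le_inf).trans (Finset.inf_le h𝔪T)
        exact this hg
      have h1 : (1 : 𝓞 K) = (x * g + f) - x * g + g := by linear_combination -hfg
      apply h𝔪.ne_top
      rw [eq_top_iff_one, h1]
      exact 𝔪.add_mem (Submodule.sub_mem _ hy𝔪 (𝔪.mul_mem_left x hg𝔪)) hg𝔪

/-- The reduction map `(𝓞/𝔮)ˣ → (𝓞/𝔣)ˣ` for `𝔮 ⊆ 𝔣`. [folklore] -/
def unitsMap (hle : 𝔮 ≤ 𝔣) : (𝓞 K ⧸ 𝔮)ˣ →* (𝓞 K ⧸ 𝔣)ˣ :=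
  Units.map (Ideal.Quotient.factor hle).toMonoidHom

omit [NumberField K] in
/-- The reduction map on representatives. [folklore] -/
theorem coe_unitsMap (hle : 𝔮 ≤ 𝔣) (u : (𝓞 K ⧸ 𝔮)ˣ) (b : 𝓞 K) (hb : Ideal.Quotient.mk 𝔮 b = u) :
    ((unitsMap hle u : (𝓞 K ⧸ 𝔣)ˣ) : 𝓞 K ⧸ 𝔣) = Ideal.Quotient.mk 𝔣 b := by
  simp [unitsMap, ← hb]

/-- **`(𝓞/𝔮)ˣ → (𝓞/𝔣)ˣ` is surjective.** [folklore] -/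
theorem unitsMap_surjective (h𝔮 : 𝔮 ≠ ⊥) (hle : 𝔮 ≤ 𝔣) : Function.Surjective (unitsMap hle) := by
  intro v
  obtain ⟨b, hb⟩ := Ideal.Quotient.mk_surjective (v : 𝓞 K ⧸ 𝔣)
  have hbu : IsUnit (Ideal.Quotient.mk 𝔣 b) := by rw [hb]; exact v.isUnit
  obtain ⟨y, hy, hyu⟩ := exists_lift_isUnit h𝔮 hbu
  refine ⟨hyu.unit, Units.ext ?_⟩
  rw [coe_unitsMap hle hyu.unit y (by simp), ← hb, Ideal.Quotient.eq]
  exact hy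

omit [NumberField K] in
/-- The kernel of the reduction map: `u ≡ 1 mod 𝔣`. [folklore] -/
theorem mem_ker_unitsMap_iff (hle : 𝔮 ≤ 𝔣) {u : (𝓞 K ⧸ 𝔮)ˣ} {b : 𝓞 K}
    (hb : Ideal.Quotient.mk 𝔮 b = u) : u ∈ (unitsMap hle).ker ↔ b - 1 ∈ 𝔣 := by
  rw [MonoidHom.mem_ker, Units.ext_iff, coe_unitsMap hle u b hb, Units.val_one,
    ← (Ideal.Quotient.mk 𝔣).map_one, Ideal.Quotient.eq]

end Units

/-! ## Descending a character to a divisor modulus -/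

section Descend

variable {𝔮 𝔣 : Ideal (𝓞 K)}

/-- `χ mod 𝔮` is trivial on the congruence subgroup `{b ≡ 1 mod 𝔣}`. [folklore] -/
def TrivialOn (𝔣 : Ideal (𝓞 K)) (χ : AddChar (Additive ((𝓞 K ⧸ 𝔮)ˣ)) ℂ) : Prop :=
  ∀ b : 𝓞 K, IsUnit (Ideal.Quotient.mk 𝔮 b) → b - 1 ∈ 𝔣 → unitValue χ (Ideal.Quotient.mk 𝔮 b) = 1

omit [NumberField K] in
/-- Every character is trivial on `{b ≡ 1 mod 𝔮}`. [folklore] -/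
theorem trivialOn_self (χ : AddChar (Additive ((𝓞 K ⧸ 𝔮)ˣ)) ℂ) : TrivialOn 𝔮 χ := by
  intro b _ hb
  have : Ideal.Quotient.mk 𝔮 b = 1 := by
    rw [← (Ideal.Quotient.mk 𝔮).map_one, Ideal.Quotient.eq]; exact hb
  rw [this, ← Units.val_one, unitValue_coe, map_one]

omit [NumberField K] in
/-- The kernel of the reduction map is killed by a character trivial on `{b ≡ 1 mod 𝔣}`.
[folklore] -/
theorem ker_le_ker (hle : 𝔮 ≤ 𝔣) {χ : AddChar (Additive ((𝓞 K ⧸ 𝔮)ˣ)) ℂ} (hχ : TrivialOn 𝔣 χ) :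
    (unitsMap hle).ker ≤ (toMulHom χ).ker := by
  intro u hu
  obtain ⟨b, hb⟩ := Ideal.Quotient.mk_surjective (u : 𝓞 K ⧸ 𝔮)
  have hbu : IsUnit (Ideal.Quotient.mk 𝔮 b) := by rw [hb]; exact u.isUnit
  rw [MonoidHom.mem_ker, ← unitValue_coe, ← hb]
  exact hχ b hbu ((mem_ker_unitsMap_iff hle hb).1 hu)

/-- **The descended character** `χ* mod 𝔣` of a character `χ mod 𝔮` trivial on `{b ≡ 1 mod 𝔣}`
(`𝔮 ⊆ 𝔣`, `𝔮 ≠ 0`). [cite: NeukirchANT1999, Ch. VII §6] -/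
def induced (h𝔮 : 𝔮 ≠ ⊥) (hle : 𝔮 ≤ 𝔣) (χ : AddChar (Additive ((𝓞 K ⧸ 𝔮)ˣ)) ℂ) (hχ : TrivialOn 𝔣 χ) :
    AddChar (Additive ((𝓞 K ⧸ 𝔣)ˣ)) ℂ :=
  AddChar.toMonoidHomEquiv.symm
    ((QuotientGroup.lift _ (toMulHom χ) (ker_le_ker hle hχ)).comp
      (QuotientGroup.quotientKerEquivOfSurjective _ (unitsMap_surjective h𝔮 hle)).symm.toMonoidHom)

omit [NumberField K] in
/-- `toMulHom` inverts `toMonoidHomEquiv.symm`. [folklore] -/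
theorem toMulHom_toMonoidHomEquiv_symm {G : Type*} [CommGroup G] (f : G →* ℂ) (g : G) :
    toMulHom (AddChar.toMonoidHomEquiv.symm f : AddChar (Additive G) ℂ) g = f g := rfl

/-- The descended character on the image of a unit. [folklore] -/
theorem toMulHom_induced_unitsMap (h𝔮 : 𝔮 ≠ ⊥) (hle : 𝔮 ≤ 𝔣) (χ : AddChar (Additive ((𝓞 K ⧸ 𝔮)ˣ)) ℂ)
    (hχ : TrivialOn 𝔣 χ) (u : (𝓞 K ⧸ 𝔮)ˣ) :
    toMulHom (induced h𝔮 hle χ hχ) (unitsMap hle u) = toMulHom χ u := by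
  set e := QuotientGroup.quotientKerEquivOfSurjective _ (unitsMap_surjective h𝔮 hle) with he
  have h1 : e.symm (unitsMap hle u) = (u : (𝓞 K ⧸ 𝔮)ˣ ⧸ (unitsMap hle).ker) := by
    rw [MulEquiv.symm_apply_eq]; rfl
  rw [induced, toMulHom_toMonoidHomEquiv_symm]
  change (QuotientGroup.lift (unitsMap hle).ker (toMulHom χ) (ker_le_ker hle hχ)) (e.symm (unitsMap hle u)) = _
  rw [h1, QuotientGroup.lift_mk]

/-- **The descended character induces `χ`**: `χ(b) = χ*(b mod 𝔣)` for `b` prime to `𝔮`.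
[cite: NeukirchANT1999, Ch. VII §6] -/
theorem unitValue_induced (h𝔮 : 𝔮 ≠ ⊥) (hle : 𝔮 ≤ 𝔣) (χ : AddChar (Additive ((𝓞 K ⧸ 𝔮)ˣ)) ℂ)
    (hχ : TrivialOn 𝔣 χ) {b : 𝓞 K} (hb : IsUnit (Ideal.Quotient.mk 𝔮 b)) :
    unitValue χ (Ideal.Quotient.mk 𝔮 b) = unitValue (induced h𝔮 hle χ hχ) (Ideal.Quotient.mk 𝔣 b) := by
  have h1 : Ideal.Quotient.mk 𝔣 b = ((unitsMap hle hb.unit : (𝓞 K ⧸ 𝔣)ˣ) : 𝓞 K ⧸ 𝔣) :=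
    (coe_unitsMap hle hb.unit b (by simp)).symm
  rw [h1, unitValue_coe, toMulHom_induced_unitsMap, ← unitValue_coe, IsUnit.unit_spec]

end Descend

/-! ## Existence of a primitive inducing character -/

section Conductor

variable {𝔮 : Ideal (𝓞 K)}

open Literature.NumberTheory.LFunctions.NumberField (idealDivisors mem_idealDivisors idealsLE mem_idealsLE)

/-- **Every character mod `𝔮` is induced by a primitive character** modulo some `𝔣 ∣ 𝔮`
(a maximal `𝔣 ⊇ 𝔮` on whose congruence subgroup `χ` is trivial), and `𝔣 ≠ 1` if `χ` is
nontrivial. [cite: NeukirchANT1999, Ch. VII §6] -/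
theorem exists_isPrimitiveChar_inducing (h𝔮 : 𝔮 ≠ ⊥) (χ : AddChar (Additive ((𝓞 K ⧸ 𝔮)ˣ)) ℂ) :
    ∃ 𝔣 : Ideal (𝓞 K), 𝔣 ∣ 𝔮 ∧ ∃ ψ : AddChar (Additive ((𝓞 K ⧸ 𝔣)ˣ)) ℂ, IsPrimitiveChar 𝔣 ψ ∧
      (∀ b : 𝓞 K, IsUnit (Ideal.Quotient.mk 𝔮 b) →
        unitValue χ (Ideal.Quotient.mk 𝔮 b) = unitValue ψ (Ideal.Quotient.mk 𝔣 b)) ∧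
      (χ ≠ 0 → 𝔣 ≠ ⊤) := by
  set S := (idealDivisors K 𝔮).filter (fun 𝔣 => TrivialOn 𝔣 χ) with hS
  have h𝔮S : 𝔮 ∈ S := by
    rw [hS, Finset.mem_filter, mem_idealDivisors h𝔮]; exact ⟨dvd_rfl, trivialOn_self χ⟩
  obtain ⟨𝔣, h𝔣S, h𝔣max⟩ := S.exists_maximal ⟨𝔮, h𝔮S⟩
  rw [hS, Finset.mem_filter, mem_idealDivisors h𝔮] at h𝔣S
  obtain ⟨h𝔣𝔮, hT⟩ := h𝔣S
  have hle : 𝔮 ≤ 𝔣 := Ideal.le_of_dvd h𝔣𝔮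
  refine ⟨𝔣, h𝔣𝔮, induced h𝔮 hle χ hT, ⟨fun 𝔣' h𝔣𝔣' hne => ?_⟩,
    fun b hb => unitValue_induced h𝔮 hle χ hT hb, fun hχ htop => hχ ?_⟩
  · -- primitivity from maximality
    by_contra H
    push Not at H
    have h𝔣'S : 𝔣' ∈ S := by
      rw [hS, Finset.mem_filter, mem_idealDivisors h𝔮]
      refine ⟨Ideal.dvd_iff_le.2 (hle.trans h𝔣𝔣'), fun b hb hb1 => ?_⟩
      rw [unitValue_induced h𝔮 hle χ hT hb]
      have hb' : IsUnit (Ideal.Quotient.mk 𝔣 b) := by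
        have := hb.map (Ideal.Quotient.factor hle)
        rwa [Ideal.Quotient.factor_mk] at this
      exact H b hb' hb1
    exact hne (le_antisymm (h𝔣max h𝔣'S h𝔣𝔣') h𝔣𝔣')
  · -- `𝔣 = 1` forces `χ` trivial
    subst htop
    refine DFunLike.ext _ _ fun a => ?_
    set u : (𝓞 K ⧸ 𝔮)ˣ := Additive.toMul a with hu
    obtain ⟨b, hb⟩ := Ideal.Quotient.mk_surjective (u : 𝓞 K ⧸ 𝔮)
    have hbu : IsUnit (Ideal.Quotient.mk 𝔮 b) := by rw [hb]; exact u.isUnit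
    have h1 := hT b hbu Submodule.mem_top
    rw [hb, unitValue_coe, toMulHom_apply, hu] at h1
    rw [AddChar.zero_apply]
    exact h1

end Conductor

/-! ## Primitive characters as a `Finset`; the index set `{(𝔣, χ)}` -/

section PrimChars

open Literature.NumberTheory.LFunctions.NumberField (idealDivisors mem_idealDivisors idealsLE mem_idealsLE)

variable (K) in
/-- The primitive characters of `(𝓞_K/𝔣)ˣ`, as a `Finset` (empty for `𝔣 = 0`). [folklore] -/
def primChars (𝔣 : Ideal (𝓞 K)) : Finset (AddChar (Additive ((𝓞 K ⧸ 𝔣)ˣ)) ℂ) :=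
  if h : 𝔣 = ⊥ then ∅ else
    haveI : Finite (𝓞 K ⧸ 𝔣) := Ideal.finiteQuotientOfFreeOfNeBot 𝔣 h
    (Finset.univ : Finset (AddChar (Additive ((𝓞 K ⧸ 𝔣)ˣ)) ℂ)).filter (IsPrimitiveChar 𝔣)

/-- Membership in `primChars`. [folklore] -/
theorem mem_primChars {𝔣 : Ideal (𝓞 K)} (h𝔣 : 𝔣 ≠ ⊥) {χ : AddChar (Additive ((𝓞 K ⧸ 𝔣)ˣ)) ℂ} :
    χ ∈ primChars K 𝔣 ↔ IsPrimitiveChar 𝔣 χ := by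
  rw [primChars, dif_neg h𝔣]
  simp

variable (K) in
/-- The index set `{(𝔣, χ)}` of moduli with characters. [folklore] -/
abbrev CharIdx : Type _ := Σ 𝔣 : Ideal (𝓞 K), AddChar (Additive ((𝓞 K ⧸ 𝔣)ˣ)) ℂ

omit [NumberField K] in
/-- Equal pairs `(𝔣, χ)` have equal character values. [folklore] -/
theorem unitValue_eq_of_sigma_eq {j j' : CharIdx K} (h : j = j') (b : 𝓞 K) :
    unitValue j.2 (Ideal.Quotient.mk j.1 b) = unitValue j'.2 (Ideal.Quotient.mk j'.1 b) := by
  subst h; rfl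

end PrimChars

/-! ## Character sums: the reduction inequality -/

section Sums

open Literature.NumberTheory.LFunctions.NumberField (idealDivisors mem_idealDivisors idealsLE mem_idealsLE)

variable (B : Finset (𝓞 K)) (W : 𝓞 K → ℂ)

/-- The character sum `S_𝔮(χ) = ∑_{α ∈ B} w(α) χ(α mod 𝔮)`. [cite: Hinz1988, §1] -/
def charSum (𝔮 : Ideal (𝓞 K)) (χ : AddChar (Additive ((𝓞 K ⧸ 𝔮)ˣ)) ℂ) : ℂ :=
  ∑ α ∈ B, W α * unitValue χ (Ideal.Quotient.mk 𝔮 α)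

/-- The weight of the `α ∈ B` not prime to `𝔮`. [folklore] -/
def badSum (𝔮 : Ideal (𝓞 K)) : ℝ := ∑ α ∈ B.filter (fun α => ¬ IsUnit (Ideal.Quotient.mk 𝔮 α)), ‖W α‖

omit [NumberField K] in
/-- `badSum ≥ 0`. [folklore] -/
theorem badSum_nonneg (𝔮 : Ideal (𝓞 K)) : 0 ≤ badSum B W 𝔮 := Finset.sum_nonneg fun _ _ => norm_nonneg _

variable {B W}

omit [NumberField K] in
/-- **Induced characters have almost the same sums**: if `χ(b) = ψ(b mod 𝔣)` for `b` prime to `𝔮`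
then `|S_𝔮(χ) − S_𝔣(ψ)| ≤ ∑_{α ∈ B not prime to 𝔮} |w(α)|`. [cite: Hinz1988, §2 (2.4)] -/
theorem norm_charSum_sub_le {𝔮 𝔣 : Ideal (𝓞 K)} [Finite ((𝓞 K ⧸ 𝔣)ˣ)]
    {χ : AddChar (Additive ((𝓞 K ⧸ 𝔮)ˣ)) ℂ} {ψ : AddChar (Additive ((𝓞 K ⧸ 𝔣)ˣ)) ℂ}
    (hind : ∀ b : 𝓞 K, IsUnit (Ideal.Quotient.mk 𝔮 b) →
      unitValue χ (Ideal.Quotient.mk 𝔮 b) = unitValue ψ (Ideal.Quotient.mk 𝔣 b)) :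
    ‖charSum B W 𝔮 χ - charSum B W 𝔣 ψ‖ ≤ badSum B W 𝔮 := by
  rw [charSum, charSum, ← Finset.sum_sub_distrib, badSum, Finset.sum_filter]
  refine (norm_sum_le _ _).trans (Finset.sum_le_sum fun α _ => ?_)
  by_cases hα : IsUnit (Ideal.Quotient.mk 𝔮 α)
  · rw [if_neg (not_not.2 hα), hind α hα, sub_self, norm_zero]
  · rw [if_pos hα, unitValue_of_not_isUnit χ hα, mul_zero, zero_sub, norm_neg, norm_mul]
    calc ‖W α‖ * ‖unitValue ψ (Ideal.Quotient.mk 𝔣 α)‖ ≤ ‖W α‖ * 1 :=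
          mul_le_mul_of_nonneg_left (norm_unitValue_le ψ _) (norm_nonneg _)
      _ = ‖W α‖ := mul_one _

/-- **Reduction to primitive characters**:
`∑_{χ ≠ χ₀ mod 𝔮} |S_𝔮(χ)| ≤ ∑_{𝔣 ∣ 𝔮, 𝔣 ≠ 1} ∑_{ψ primitive mod 𝔣} |S_𝔣(ψ)| + #{χ mod 𝔮} · bad(𝔮)`.
[cite: Hinz1988, §2 (2.3)–(2.5)] -/
theorem sum_norm_charSum_le {𝔮 : Ideal (𝓞 K)} (h𝔮 : 𝔮 ≠ ⊥) [Fintype (𝓞 K ⧸ 𝔮)] :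
    ∑ χ ∈ (Finset.univ : Finset (AddChar (Additive ((𝓞 K ⧸ 𝔮)ˣ)) ℂ)).erase 0, ‖charSum B W 𝔮 χ‖ ≤
      (∑ 𝔣 ∈ (idealDivisors K 𝔮).filter (· ≠ ⊤), ∑ ψ ∈ primChars K 𝔣, ‖charSum B W 𝔣 ψ‖) +
        Fintype.card (AddChar (Additive ((𝓞 K ⧸ 𝔮)ˣ)) ℂ) * badSum B W 𝔮 := by
  -- choose an inducing primitive character for every `χ`
  choose cond hcond prim hprim hind hne using fun χ : AddChar (Additive ((𝓞 K ⧸ 𝔮)ˣ)) ℂ =>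
    exists_isPrimitiveChar_inducing h𝔮 χ
  set g : AddChar (Additive ((𝓞 K ⧸ 𝔮)ˣ)) ℂ → CharIdx K := fun χ => ⟨cond χ, prim χ⟩ with hg
  set F : CharIdx K → ℝ := fun j => ‖charSum B W j.1 j.2‖ with hF
  have hF0 : ∀ j, 0 ≤ F j := fun j => norm_nonneg _
  -- finiteness instances along the divisors
  have hfin : ∀ χ, Finite ((𝓞 K ⧸ cond χ)ˣ) := fun χ => by
    haveI : Finite (𝓞 K ⧸ cond χ) :=
      Ideal.finiteQuotientOfFreeOfNeBot _ (ne_bot_of_dvd_ne_bot h𝔮 (hcond χ))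
    infer_instance
  -- termwise: `|S_𝔮(χ)| ≤ |S_{𝔣_χ}(ψ_χ)| + bad`
  have hterm : ∀ χ, ‖charSum B W 𝔮 χ‖ ≤ F (g χ) + badSum B W 𝔮 := by
    intro χ
    haveI := hfin χ
    have h := norm_charSum_sub_le (B := B) (W := W) (hind χ)
    have := norm_le_norm_add_norm_sub' (charSum B W 𝔮 χ) (charSum B W (cond χ) (prim χ))
    simp only [hF, hg]
    linarith [norm_sub_rev (charSum B W 𝔮 χ) (charSum B W (cond χ) (prim χ))]
  -- `g` is injective
  have hginj : Function.Injective g := by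
    intro χ χ' h
    simp only [hg] at h
    refine DFunLike.ext _ _ fun a => ?_
    set u : (𝓞 K ⧸ 𝔮)ˣ := Additive.toMul a with hu
    obtain ⟨b, hb⟩ := Ideal.Quotient.mk_surjective (u : 𝓞 K ⧸ 𝔮)
    have hbu : IsUnit (Ideal.Quotient.mk 𝔮 b) := by rw [hb]; exact u.isUnit
    have e1 := hind χ b hbu
    have e2 := hind χ' b hbu
    have e3 : unitValue (prim χ) (Ideal.Quotient.mk (cond χ) b) =
        unitValue (prim χ') (Ideal.Quotient.mk (cond χ') b) := unitValue_eq_of_sigma_eq h b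
    rw [hb, unitValue_coe, toMulHom_apply] at e1 e2
    rw [show χ a = χ (Additive.ofMul u) from rfl, e1, e3, ← e2]
    simp [hu]
  -- the image of the nontrivial characters lies in `{(𝔣, ψ) : 𝔣 ∣ 𝔮, 𝔣 ≠ 1, ψ primitive}`
  set J := ((idealDivisors K 𝔮).filter (· ≠ ⊤)).sigma (primChars K) with hJ
  have himage : ((Finset.univ : Finset (AddChar (Additive ((𝓞 K ⧸ 𝔮)ˣ)) ℂ)).erase 0).image g ⊆ J := by
    intro j hj
    obtain ⟨χ, hχ, rfl⟩ := Finset.mem_image.1 hj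
    have hχ0 : χ ≠ 0 := (Finset.mem_erase.1 hχ).1
    rw [hJ, Finset.mem_sigma, Finset.mem_filter, mem_idealDivisors h𝔮,
      mem_primChars (ne_bot_of_dvd_ne_bot h𝔮 (hcond χ))]
    exact ⟨⟨hcond χ, hne χ hχ0⟩, hprim χ⟩
  calc ∑ χ ∈ (Finset.univ : Finset (AddChar (Additive ((𝓞 K ⧸ 𝔮)ˣ)) ℂ)).erase 0, ‖charSum B W 𝔮 χ‖
      ≤ ∑ χ ∈ (Finset.univ : Finset (AddChar (Additive ((𝓞 K ⧸ 𝔮)ˣ)) ℂ)).erase 0,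
          (F (g χ) + badSum B W 𝔮) := Finset.sum_le_sum fun χ _ => hterm χ
    _ = (∑ χ ∈ (Finset.univ : Finset (AddChar (Additive ((𝓞 K ⧸ 𝔮)ˣ)) ℂ)).erase 0, F (g χ)) +
          ((Finset.univ : Finset (AddChar (Additive ((𝓞 K ⧸ 𝔮)ˣ)) ℂ)).erase 0).card * badSum B W 𝔮 := by
        rw [Finset.sum_add_distrib, Finset.sum_const, nsmul_eq_mul]
    _ ≤ (∑ j ∈ J, F j) + Fintype.card (AddChar (Additive ((𝓞 K ⧸ 𝔮)ˣ)) ℂ) * badSum B W 𝔮 := by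
        gcongr
        · rw [← Finset.sum_image fun χ _ χ' _ h => hginj h]
          exact Finset.sum_le_sum_of_subset_of_nonneg himage fun j _ _ => hF0 j
        · exact badSum_nonneg B W 𝔮
        · exact_mod_cast (Finset.card_erase_le).trans (Finset.card_univ (α := AddChar _ ℂ)).le
    _ = _ := by rw [hJ, Finset.sum_sigma]

end Sums

/-! ## `φ(𝔣𝔤) ≥ φ(𝔣)φ(𝔤)` and the swap of the sums over moduli -/

section Swap

open Literature.NumberTheory.LFunctions.NumberField (idealDivisors mem_idealDivisors idealsLE mem_idealsLE)

/-- **Supermultiplicativity of `φ`**: `φ(𝔣𝔤) ≥ φ(𝔣) φ(𝔤)` for nonzero ideals. [folklore] -/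
theorem idealTotient_mul_ge {𝔣 𝔤 : Ideal (𝓞 K)} (h𝔣 : 𝔣 ≠ ⊥) (h𝔤 : 𝔤 ≠ ⊥) :
    idealTotient K 𝔣 * idealTotient K 𝔤 ≤ idealTotient K (𝔣 * 𝔤) := by
  set f : Ideal (𝓞 K) → ℝ := fun P => 1 - 1 / (Ideal.absNorm P : ℝ) with hf
  have hf01 : ∀ P ∈ (normalizedFactors 𝔣).toFinset ∪ (normalizedFactors 𝔤).toFinset, 0 < f P ∧ f P ≤ 1 := by
    intro P hP
    have hP : P ∈ normalizedFactors 𝔣 ∨ P ∈ normalizedFactors 𝔤 := by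
      rwa [Finset.mem_union, Multiset.mem_toFinset, Multiset.mem_toFinset] at hP
    have hPp : P.IsPrime := by
      rcases hP with h | h <;> exact Ideal.isPrime_of_prime (prime_of_normalized_factor P h)
    have hP0 : P ≠ ⊥ := by
      rcases hP with h | h <;> exact (prime_of_normalized_factor P h).ne_zero
    have hPm : P.IsMaximal := hPp.isMaximal hP0
    have h2 : (2 : ℝ) ≤ Ideal.absNorm P := by
      have := Ideal.absNorm_eq_one_iff.not.2 hPm.ne_top
      have h1 : 1 ≤ Ideal.absNorm P := Nat.one_le_iff_ne_zero.2 (by rwa [Ne, Ideal.absNorm_eq_zero_iff])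
      exact_mod_cast (lt_of_le_of_ne h1 (Ne.symm this))
    simp only [hf]
    constructor
    · have : 1 / (Ideal.absNorm P : ℝ) < 1 := by rw [div_lt_one (by positivity)]; linarith
      linarith
    · have : 0 ≤ 1 / (Ideal.absNorm P : ℝ) := by positivity
      linarith
  have hunion : (normalizedFactors (𝔣 * 𝔤)).toFinset =
      (normalizedFactors 𝔣).toFinset ∪ (normalizedFactors 𝔤).toFinset := by
    rw [normalizedFactors_mul h𝔣 h𝔤, Multiset.toFinset_add]
  simp only [idealTotient]
  rw [hunion, map_mul, Nat.cast_mul]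
  set A := (normalizedFactors 𝔣).toFinset
  set Bf := (normalizedFactors 𝔤).toFinset
  have hkey : (∏ P ∈ A, f P) * ∏ P ∈ Bf, f P ≤ ∏ P ∈ A ∪ Bf, f P := by
    rw [← Finset.prod_union_inter]
    have h1 : ∏ P ∈ A ∩ Bf, f P ≤ 1 :=
      Finset.prod_le_one (fun P hP => (hf01 P (Finset.mem_union_left _ (Finset.mem_inter.1 hP).1)).1.le)
        fun P hP => (hf01 P (Finset.mem_union_left _ (Finset.mem_inter.1 hP).1)).2
    have h0 : 0 ≤ ∏ P ∈ A ∪ Bf, f P := Finset.prod_nonneg fun P hP => (hf01 P hP).1.le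
    calc (∏ P ∈ A ∪ Bf, f P) * ∏ P ∈ A ∩ Bf, f P ≤ (∏ P ∈ A ∪ Bf, f P) * 1 :=
          mul_le_mul_of_nonneg_left h1 h0
      _ = _ := mul_one _
  have hN : 0 ≤ (Ideal.absNorm 𝔣 : ℝ) * Ideal.absNorm 𝔤 := by positivity
  calc (Ideal.absNorm 𝔣 : ℝ) * (∏ P ∈ A, f P) * ((Ideal.absNorm 𝔤 : ℝ) * ∏ P ∈ Bf, f P)
      = (Ideal.absNorm 𝔣 : ℝ) * Ideal.absNorm 𝔤 * ((∏ P ∈ A, f P) * ∏ P ∈ Bf, f P) := by ring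
    _ ≤ (Ideal.absNorm 𝔣 : ℝ) * Ideal.absNorm 𝔤 * ∏ P ∈ A ∪ Bf, f P := mul_le_mul_of_nonneg_left hkey hN

/-- **Swapping the sums over `𝔮` and its divisors**: for `G ≥ 0`,
`∑_{N𝔮≤Q} φ(𝔮)⁻¹ ∑_{𝔣∣𝔮, 𝔣≠1} G(𝔣) ≤ (∑_{N𝔤≤Q} φ(𝔤)⁻¹) · ∑_{N𝔣≤Q, 𝔣≠1} φ(𝔣)⁻¹ G(𝔣)`
(`𝔮 = 𝔣𝔤`, `φ(𝔣𝔤) ≥ φ(𝔣)φ(𝔤)`). [cite: Hinz1988, §2 (2.5)] -/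
theorem sum_inv_totient_sum_divisors_le (Q : ℝ) (G : Ideal (𝓞 K) → ℝ) (hG : ∀ 𝔣, 0 ≤ G 𝔣) :
    ∑ 𝔮 ∈ idealsLE K Q, (idealTotient K 𝔮)⁻¹ * ∑ 𝔣 ∈ (idealDivisors K 𝔮).filter (· ≠ ⊤), G 𝔣 ≤
      (∑ 𝔤 ∈ idealsLE K Q, (idealTotient K 𝔤)⁻¹) *
        ∑ 𝔣 ∈ (idealsLE K Q).filter (· ≠ ⊤), (idealTotient K 𝔣)⁻¹ * G 𝔣 := by
  -- as a sum over pairs `(𝔮, 𝔣)`, `𝔣 ∣ 𝔮`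
  set P := (idealsLE K Q).sigma (fun 𝔮 => (idealDivisors K 𝔮).filter (· ≠ ⊤)) with hP
  set P' := ((idealsLE K Q).filter (· ≠ ⊤)).sigma (fun _ => idealsLE K Q) with hP'
  set e : (Σ _ : Ideal (𝓞 K), Ideal (𝓞 K)) → (Σ _ : Ideal (𝓞 K), Ideal (𝓞 K)) :=
    fun p => ⟨p.2, cofactor p.1 p.2⟩ with he
  set F' : (Σ _ : Ideal (𝓞 K), Ideal (𝓞 K)) → ℝ :=
    fun p => (idealTotient K p.1)⁻¹ * G p.1 * (idealTotient K p.2)⁻¹ with hF'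
  have hmemP : ∀ p ∈ P, p.1 ≠ ⊥ ∧ (Ideal.absNorm p.1 : ℝ) ≤ Q ∧ p.2 ∣ p.1 ∧ p.2 ≠ ⊤ := by
    intro p hp
    rw [hP, Finset.mem_sigma, mem_idealsLE, Finset.mem_filter] at hp
    rw [mem_idealDivisors hp.1.1] at hp
    exact ⟨hp.1.1, hp.1.2, hp.2.1, hp.2.2⟩
  have hF'0 : ∀ p, 0 ≤ F' p := fun p => by
    simp only [hF']
    have := hG p.1
    have h1 : 0 ≤ (idealTotient K p.1)⁻¹ := by
      by_cases h : p.1 = ⊥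
      · simp [idealTotient, h]
      · exact (inv_pos.2 (idealTotient_pos h)).le
    have h2 : 0 ≤ (idealTotient K p.2)⁻¹ := by
      by_cases h : p.2 = ⊥
      · simp [idealTotient, h]
      · exact (inv_pos.2 (idealTotient_pos h)).le
    positivity
  -- termwise comparison
  have hterm : ∀ p ∈ P, (idealTotient K p.1)⁻¹ * G p.2 ≤ F' (e p) := by
    intro p hp
    obtain ⟨h1, -, hdvd, -⟩ := hmemP p hp
    have h2 : p.2 ≠ ⊥ := ne_bot_of_dvd_ne_bot h1 hdvd
    have hc : cofactor p.1 p.2 ≠ ⊥ := cofactor_ne_bot h1 hdvd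
    simp only [hF', he]
    have hmul : idealTotient K p.2 * idealTotient K (cofactor p.1 p.2) ≤ idealTotient K p.1 := by
      have := idealTotient_mul_ge (K := K) h2 hc
      rwa [mul_cofactor hdvd] at this
    have hpos := mul_pos (idealTotient_pos h2) (idealTotient_pos hc)
    calc (idealTotient K p.1)⁻¹ * G p.2 ≤ (idealTotient K p.2 * idealTotient K (cofactor p.1 p.2))⁻¹ * G p.2 :=
          mul_le_mul_of_nonneg_right (inv_anti₀ hpos hmul) (hG _)
      _ = _ := by rw [mul_inv]; ring
  -- `e` is injective on `P` and maps into `P'`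
  have heinj : Set.InjOn e P := by
    intro p hp p' hp' h
    simp only [he] at h
    obtain ⟨h1, h2⟩ := Sigma.mk.inj_iff.1 h
    rw [heq_iff_eq] at h2
    have e3 : p.1 = p'.1 :=
      calc p.1 = p.2 * cofactor p.1 p.2 := (mul_cofactor (hmemP p hp).2.2.1).symm
        _ = p'.2 * cofactor p'.1 p'.2 := by rw [h2, h1]
        _ = p'.1 := mul_cofactor (hmemP p' hp').2.2.1
    exact Sigma.ext e3 (heq_of_eq h1)
  have heP' : ∀ p ∈ P, e p ∈ P' := by
    intro p hp
    obtain ⟨h1, hN, hdvd, htop⟩ := hmemP p hp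
    have h2 : p.2 ≠ ⊥ := ne_bot_of_dvd_ne_bot h1 hdvd
    have hle_of_dvd : ∀ {𝔞 : Ideal (𝓞 K)}, 𝔞 ∣ p.1 → (Ideal.absNorm 𝔞 : ℝ) ≤ Q := by
      intro 𝔞 h𝔞
      have hpos : 0 < Ideal.absNorm p.1 := Nat.pos_of_ne_zero (by rw [Ne, Ideal.absNorm_eq_zero_iff]; exact h1)
      have := Nat.le_of_dvd hpos (Ideal.absNorm_dvd_absNorm_of_le (Ideal.le_of_dvd h𝔞))
      exact le_trans (by exact_mod_cast this) hN
    have hN2 : (Ideal.absNorm p.2 : ℝ) ≤ Q := hle_of_dvd hdvd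
    have hNc : (Ideal.absNorm (cofactor p.1 p.2) : ℝ) ≤ Q := hle_of_dvd (cofactor_dvd hdvd)
    rw [hP', Finset.mem_sigma, Finset.mem_filter, mem_idealsLE, mem_idealsLE]
    exact ⟨⟨⟨h2, hN2⟩, htop⟩, cofactor_ne_bot h1 hdvd, hNc⟩
  calc ∑ 𝔮 ∈ idealsLE K Q, (idealTotient K 𝔮)⁻¹ * ∑ 𝔣 ∈ (idealDivisors K 𝔮).filter (· ≠ ⊤), G 𝔣
      = ∑ p ∈ P, (idealTotient K p.1)⁻¹ * G p.2 := by
        rw [hP, Finset.sum_sigma]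
        exact Finset.sum_congr rfl fun 𝔮 _ => Finset.mul_sum _ _ _
    _ ≤ ∑ p ∈ P, F' (e p) := Finset.sum_le_sum hterm
    _ = ∑ p ∈ P.image e, F' p := (Finset.sum_image heinj).symm
    _ ≤ ∑ p ∈ P', F' p := Finset.sum_le_sum_of_subset_of_nonneg
        (fun p hp => by obtain ⟨p₀, hp₀, rfl⟩ := Finset.mem_image.1 hp; exact heP' p₀ hp₀)
        fun p _ _ => hF'0 p
    _ = ∑ 𝔣 ∈ (idealsLE K Q).filter (· ≠ ⊤), ∑ 𝔤 ∈ idealsLE K Q,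
          (idealTotient K 𝔣)⁻¹ * G 𝔣 * (idealTotient K 𝔤)⁻¹ := by rw [hP', Finset.sum_sigma]
    _ = _ := by
        rw [Finset.mul_sum]
        refine Finset.sum_congr rfl fun 𝔣 _ => ?_
        rw [← Finset.mul_sum]
        ring

end Swap

end Literature.NumberTheory.Sieve.PrimRed
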